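import Mathlib
import Summits.Ventures.PercRepro2.SwOutShadowMultiRootSides
import Summits.Ventures.PercRepro2.SwOutMultiRootEBase

/-!
# The base with root–root edges at a side point with ESCAPING vertices (blind cell PercRepro2,
night-4 g35, 2026-08-29; proofs/NIGHT4-G35.md §4)

g34's `multiBaseE_baseRR` and `coreRealRR_baseRR_omegaRR` (SwOutMultiRootEBase) with the fifth
alternative of `hout` — a non-root vertex of the region may ESCAPE (its hull leaves the region):
the base `baseRR` of a side point of a fibre of the escaping set is a `MultiBaseE` on the extended
hull of the non-escaping roots, and the side point is the cube point `omegaRR` of its base.  The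
proofs are g34's verbatim on the Esc versions of the side lemmas (namespace `Esc`).
-/

namespace Summit.Ventures.PercRepro2

namespace LocRows

namespace Esc

open Hull

variable {V : Type*} {E : Type*}

open scoped Classical

variable {ends : E → Sym2 V}

section NonEscaping

variable [Fintype E] [DecidableEq E] {U : Set V} {ξ : Config E} {l h : V} {R : Set V}
  {𝓤 𝓓 𝓓'' : Set (Set V)} {X : Set V} {𝓤' : Set (Set V)} {F : V → Prop} {ζ : Config E}
  (hl : l ∉ U) (hloop : ∀ e r, r ∈ R → ends e ≠ s(r, r))
  (hF : ∀ x, F x → ∀ S ∈ 𝓤, x ∈ S)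
  (hout : ∀ x ∈ U, x ∉ R →
    F x ∨ x ∈ X ∨ (∃ e y, ends e = s(x, y) ∧ y ∉ U) ∨ (∀ e, x ∉ ends e) ∨ ¬ hull ends ζ x ⊆ U)
  (hX : ∀ x ∈ X, x ∈ U → ∀ e, x ∈ ends e → ends e = s(x, x))
  (hζ : ζ ∈ gOutSide ends l h 𝓤 𝓓 𝓓'' X 𝓤' U ξ)
  (hne : ∀ r ∈ R, hull ends ζ r ⊆ U)
include hl hloop hF hout hX hζ hne

omit hloop in
/-- The arms assigned `false` by `omegaR` are exactly the blue part. -/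
lemma armsFalseC_omegaR :
    armsFalseC (armsFun (armsR ends R ζ)) (omegaR ends R ζ) = bluePartR ends R ζ := by
  ext x
  constructor
  · rintro ⟨P, hP, hx⟩
    have : P.1 ⊆ bluePartR ends R ζ := by
      by_contra h'
      simp only [omegaR, decide_eq_false_iff_not, not_not] at hP
      exact h' hP
    exact this hx
  · intro hx
    have hxH : x ∈ extHullR ends R ζ := bluePartR_subset hx
    refine ⟨⟨armR ends R ζ x, armR_mem_armsR_of_mem_extHullR hxH hx.2⟩, ?_, mem_armR_self x⟩
    simp only [omegaR, decide_eq_false_iff_not, not_not]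
    exact armR_subset_bluePartR hl hF hout hX hζ hne hx


/-- **The base of a side point whose non-root vertices are exempt, in `X`, carry an outside edge,
are isolated, or escape, is a multi-root base with root–root edges** on the extended hull of the
(non-escaping) roots with the arms `armsR`. -/
theorem multiBaseE_baseRR :
    MultiBaseE ends (baseRR ends R ζ) R (extHullR ends R ζ) (armsFun (armsR ends R ζ))
      (rrEdges ends R) where
  root_sub := fun r hr => mem_extHullR_of_mem hr
  bdry_blue := by
    intro e x y hxy hxH hyH
    by_cases hxR : x ∈ R
    · exact absurd ⟨x, hxR, mem_hull_of_adj_root hxy⟩ hyH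
    rw [baseRR_apply_of_notMem (notMem_rrEdges_of_notMem hxy hxR)]
    rcases mem_redPartR_or_bluePartR hxH hxR with hx | hx
    · rw [baseR_apply_of_red hl hF hout hX hζ hne hxy hx]
      obtain ⟨⟨r, hr, hxr⟩, -⟩ := hx
      cases he : ζ e with
      | true => exact absurd ⟨r, hr, Or.inl (mem_cluster_of_edge hxr he hxy)⟩ hyH
      | false => rfl
    · rw [baseR_apply_of_blue hxy hx]
      obtain ⟨⟨r, hr, hxr⟩, -⟩ := hx
      cases he : ζ e with
      | true => rfl
      | false =>
        exfalso
        have he' : blue ζ e = true := by rw [blue_eq_true_iff]; exact he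
        exact hyH ⟨r, hr, Or.inr (mem_cluster_of_edge hxr he' hxy)⟩
  arm_sub := by
    intro P x hx
    obtain ⟨y, hyH, hyR, hP⟩ := exists_of_mem_armsR P.2
    change x ∈ P.1 at hx
    rw [hP] at hx
    exact armR_subset hyH hyR hx
  arm_nonempty := by
    intro P
    obtain ⟨y, -, -, hP⟩ := exists_of_mem_armsR P.2
    refine ⟨y, ?_⟩
    change y ∈ P.1
    rw [hP]; exact mem_armR_self y
  arm_disj := by
    intro P Q hPQ x hxP hxQ
    obtain ⟨y, -, -, hP⟩ := exists_of_mem_armsR P.2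
    obtain ⟨z, -, -, hQ⟩ := exists_of_mem_armsR Q.2
    change x ∈ P.1 at hxP
    change x ∈ Q.1 at hxQ
    apply hPQ
    apply Subtype.ext
    rw [hP] at hxP
    rw [hQ] at hxQ
    rw [hP, hQ]
    exact armR_eq_armR_of_mem_of_mem hxP hxQ
  arm_cover := fun x hx hxR =>
    ⟨⟨armR ends R ζ x, armR_mem_armsR_of_mem_extHullR hx hxR⟩, mem_armR_self x⟩
  no_cross := by
    intro P Q hPQ e x y hxy hxP hyQ
    obtain ⟨p, hpH, hpR, hP⟩ := exists_of_mem_armsR P.2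
    obtain ⟨q, hqH, hqR, hQ⟩ := exists_of_mem_armsR Q.2
    change x ∈ P.1 at hxP
    change y ∈ Q.1 at hyQ
    rw [hP] at hxP
    rw [hQ] at hyQ
    have hxH := armR_subset hpH hpR hxP
    have hyH := armR_subset hqH hqR hyQ
    have h1 := armR_eq_of_edge hxy hxH hyH
    apply hPQ
    apply Subtype.ext
    rw [hP, hQ, ← armR_eq_of_mem hxP, ← armR_eq_of_mem hyQ, h1]
  root_edges := by
    intro e r x hr hrx
    by_cases hxR : x ∈ R
    · exact Or.inl hxR
    · exact Or.inr ⟨⟨armR ends R ζ x, armR_mem_armsR hr hrx hxR⟩, mem_armR_self x⟩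
  loop_root := hloop
  root_red := by
    intro e r x hr hrx
    by_cases hxR : x ∈ R
    · exact baseRR_apply_of_mem (mem_rrEdges.2 ⟨r, hr, x, hxR, hrx⟩)
    rw [baseRR_apply_of_notMem (notMem_rrEdges_of_notMem (ends_swap hrx) hxR)]
    have hxH : x ∈ extHullR ends R ζ := ⟨r, hr, mem_hull_of_adj_root hrx⟩
    rcases mem_redPartR_or_bluePartR hxH hxR with hx | hx
    · rw [baseR_apply_of_red hl hF hout hX hζ hne (ends_swap hrx) hx]
      cases he : ζ e with
      | true => rfl
      | false =>
        exfalso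
        have he' : blue ζ e = true := by rw [blue_eq_true_iff]; exact he
        exact redPartR_disjoint_bluePartR hl hF hout hX hζ hne hx
          ⟨⟨r, hr, mem_cluster_of_edge (mem_cluster_self _ _ _) he' hrx⟩, hxR⟩
    · rw [baseR_apply_of_blue (ends_swap hrx) hx]
      cases he : ζ e with
      | true =>
        exfalso
        exact redPartR_disjoint_bluePartR hl hF hout hX hζ hne
          ⟨⟨r, hr, mem_cluster_of_edge (mem_cluster_self _ _ _) he hrx⟩, hxR⟩ hx
      | false => rfl
  rr_iff := fun e => mem_rrEdges
  conn := by
    intro P x hx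
    obtain ⟨y, hyH, hyR, hP⟩ := exists_of_mem_armsR P.2
    change x ∈ P.1 at hx
    have hP' : armsFun (armsR ends R ζ) P = P.1 := rfl
    rw [hP']
    rw [hP] at hx ⊢
    have hxH := armR_subset hyH hyR hx
    have harm : armR ends R ζ x = armR ends R ζ y := armR_eq_of_mem hx
    have hPR : armR ends R ζ y ⊆ Rᶜ := fun z hz => (armR_subset hyH hyR hz).2
    rcases mem_redPartR_or_bluePartR hxH.1 hxH.2 with hxr | hxr
    · obtain ⟨r, hr, hc⟩ := exists_root_conn_inside_red hxr
      refine ⟨r, hr, ?_⟩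
      rw [harm] at hc
      have hsub : armR ends R ζ y ⊆ redPartR ends R ζ := by
        rw [← harm]; exact armR_subset_redPartR hl hF hout hX hζ hne hxr
      rw [insideConfig_baseRR hloop hPR hr, insideConfig_baseR_of_red hl hloop hF hout hX hζ hne hsub hr]
      exact hc
    · obtain ⟨r, hr, hc⟩ := exists_root_conn_inside_blue hxr
      refine ⟨r, hr, ?_⟩
      rw [harm] at hc
      have hsub : armR ends R ζ y ⊆ bluePartR ends R ζ := by
        rw [← harm]; exact armR_subset_bluePartR hl hF hout hX hζ hne hxr
      rw [insideConfig_baseRR hloop hPR hr, insideConfig_baseR_of_blue hloop hsub hr]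
      exact hc

omit hloop in
/-- **The side point is the cube point `omegaRR` of its base.** -/
theorem coreRealRR_baseRR_omegaRR :
    coreRealRR ends (armsFun (armsR ends R ζ)) (rrEdges ends R) (baseRR ends R ζ) (omegaRR ends R ζ) =
      ζ := by
  funext e
  by_cases he : e ∈ rrEdges ends R
  · rw [coreRealRR_apply_rr he, baseRR_apply_of_mem he]
    simp only [omegaRR, Sum.elim_inr]
    by_cases hz : ζ e = true
    · rw [if_pos hz, hz]
    · rw [if_neg hz, Bool.not_true]
      exact (Bool.eq_false_iff.mpr hz).symm
  · rw [coreRealRR_apply_of_notMem_rr he]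
    have h1 : (fun i => omegaRR ends R ζ (Sum.inl i)) = omegaR ends R ζ := by
      funext i; simp [omegaRR]
    rw [h1]
    unfold coreReal
    rw [armsFalseC_omegaR hl hF hout hX hζ hne]
    have h2 : ∀ P : Set V, Hull.flip ends P (baseRR ends R ζ) e = Hull.flip ends P (baseR ends R ζ) e := by
      intro P
      by_cases ht : e ∈ touches ends P
      · rw [flip_apply_of_mem ht, flip_apply_of_mem ht, baseRR_apply_of_notMem he]
      · rw [flip_apply_of_notMem ht, flip_apply_of_notMem ht, baseRR_apply_of_notMem he]
    rw [h2, baseR, Hull.flip_flip]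

end NonEscaping

end Esc

end LocRows

end Summit.Ventures.PercRepro2
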